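import Summits.QuantumAdvantage.QuantumAdvantage.Theorems.LinnikCubicClassGroupsDegreeOnePrimesEscapeLeastSplitPrime
import Summits.QuantumAdvantage.QuantumAdvantage.Theorems.LinnikCubicClassGroupsDegreeOnePrimesEscapeCubicSplittingCount
import Summits.QuantumAdvantage.QuantumAdvantage.Theorems.LinnikCubicClassGroupsDegreeOnePrimesEscapeCubicClosure
import Literature.NumberTheory.GaloisRepresentations.SplitsCompletelyCriteria
import Mathlib.NumberTheory.NumberField.Discriminant.Different
import HarnessLib

/-!
# The least completely split prime of a non-Galois cubic field is `≤ |d_K|^L`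

Topic `Summits/QuantumAdvantage/QuantumAdvantage/Theorems`, cell B2b-1 (linnik-cubic), PART A (gen 7);
helper toward the crux `DegreeOnePrimesEscape` (stmt-QuantumAdvantage-11543) of route
`LinnikCubicClassGroups`.  HONEST FRAMING: the value of this file is a THEOREM (kernel-checked, no
hypothesis) — NOT summit progress.

The identity class of `S₃`: a prime `p` splits completely in a non-Galois cubic field `K` iff it splits
completely in the Galois closure `N`; PART B's least completely split prime for Galois fields
(`exists_splitsCompletely_le_discr`, gen 6) applied to `N` together with `|d_N| ≤ |d_K|^A`
(`stub_cubicClosure`) and the splitting-type dictionary (`sextic_dictionary`) give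
`exists_splitPrime_le`: a prime `p ≤ |d_K|^{L}`, `p ∤ d_K`, with `T_K(p) = {1,1,1}`.  With
`exists_partialPrime_le` (transpositions) and `exists_inertPrime_le_of_not_isGalois` (3-cycles) this
covers all three conjugacy classes of `S₃` [LagariasMontgomeryOdlyzko1979].
-/

noncomputable section

open scoped NumberField nonZeroDivisors
open Ideal NumberField UniqueFactorizationMonoid
open Literature.NumberTheory.NumberFields Literature.NumberTheory.LFunctions
  Literature.NumberTheory.GaloisRepresentations

namespace Summit.QuantumAdvantage.QuantumAdvantage.Theorems.DegreeOnePrimesEscape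

/-- A completely split prime is unramified and has a degree-one prime above it: `p ∤ d_N` and
`a_N(p) ≠ 0`. -/
theorem count_one_ne_zero_of_splitsCompletely {N : Type*} [Field N] [NumberField N] {p : ℕ}
    (hp : p.Prime) (h : SplitsCompletely N p) :
    ¬ ((p : ℤ) ∣ NumberField.discr N) ∧ (splittingType N p).count 1 ≠ 0 := by
  classical
  rw [splitsCompletely_iff_forall_inertiaDeg_eq_one hp] at h
  obtain ⟨hunr, hdeg⟩ := h
  have hpZ : Prime (p : ℤ) := Nat.prime_iff_prime_int.mp hp
  refine ⟨(NumberField.not_dvd_discr_iff_isUnramifiedIn N (𝓞 N) hpZ).mpr hunr, ?_⟩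
  haveI : (span {(p : ℤ)}).IsMaximal := PrincipalIdealRing.isMaximal_of_irreducible hpZ.irreducible
  obtain ⟨P, hPmax, hPover⟩ :=
    Ideal.exists_maximal_ideal_liesOver_of_isIntegral (S := 𝓞 N) (span {(p : ℤ)})
  have hmem : P ∈ normalizedFactors (span {(p : 𝓞 N)}) :=
    (mem_normalizedFactors_span_iff hp).2 ⟨hPmax.isPrime, hPover⟩
  have h1 : P.inertiaDeg ℤ = 1 := hdeg P ⟨hPmax.isPrime, hPover⟩
  have hone : 1 ∈ splittingType N p := by
    rw [splittingType]
    exact Multiset.mem_map.2 ⟨P, Multiset.mem_dedup.2 hmem, h1⟩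
  exact Multiset.count_ne_zero.mpr hone

/-- **The least completely split prime of a non-Galois cubic field, unconditionally**: there is `L > 0`
such that every cubic number field `K` that is not Galois over `ℚ` has a prime `p ≤ |d_K|^{L}`, `p ∤ d_K`,
with `T_K(p) = {1, 1, 1}`. [cite: LagariasMontgomeryOdlyzko1979, Theorem 1.1] -/
theorem exists_splitPrime_le :
    ∃ L : ℝ, 0 < L ∧ ∀ (K : Type) [Field K] [NumberField K], Module.finrank ℚ K = 3 →
      ¬ IsGalois ℚ K →
        ∃ p : ℕ, p.Prime ∧ (p : ℝ) ≤ ((NumberField.discr K).natAbs : ℝ) ^ L ∧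
          ¬ ((p : ℤ) ∣ NumberField.discr K) ∧ splittingType K p = {1, 1, 1} := by
  classical
  obtain ⟨L₆, hL₆, hsplit6⟩ := exists_splitsCompletely_le_discr 6 (by norm_num)
  obtain ⟨A, hclos⟩ := stub_cubicClosure
  refine ⟨((A : ℝ) + 1) * L₆, by positivity, fun K _ _ h3 hKng => ?_⟩
  obtain ⟨N, _, _, hGal, h6, hna, ⟨K', ⟨eK⟩⟩, ⟨k, hk⟩, hdN⟩ := hclos K h3 hKng
  haveI := hGal
  have hK' : Module.finrank ℚ K' = 3 := by rw [← eK.toLinearEquiv.finrank_eq, h3]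
  have hdisc' : NumberField.discr K' = NumberField.discr K :=
    (NumberField.discr_eq_discr_of_algEquiv K eK).symm
  obtain ⟨p, hp, hsc, hple⟩ := hsplit6 N h6
  obtain ⟨hpN, hcnt⟩ := count_one_ne_zero_of_splitsCompletely hp hsc
  -- `a_N(p) = 6`, so `a_{K'}(p) = 3` and `T_{K'}(p) = {1,1,1}`
  have hN6 : (splittingType N p).count 1 = 6 := by
    rcases count_one_splittingType_eq_zero_or_eq_finrank (N := N) hp hpN with h0 | h
    · exact absurd h0 hcnt
    · rw [h, h6]
  have hK3 : (splittingType K' p).count 1 = 3 := by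
    rcases sextic_dictionary h6 hna K' k hK' hk hp hpN with ⟨-, h2, -⟩ | ⟨-, -, h3'⟩ | ⟨-, -, h3'⟩
    · exact h2
    · omega
    · omega
  have hdvdK' : ¬ ((p : ℤ) ∣ NumberField.discr K') := fun h =>
    hpN (h.trans (NumberField.discr_dvd_discr K' N))
  have hT : splittingType K' p = {1, 1, 1} := splittingType_eq_of_count_one_eq_three hK' hp hdvdK' hK3
  refine ⟨p, hp, ?_, hdisc' ▸ hdvdK', ?_⟩
  · -- `p ≤ |d_N|^{L₆} ≤ (|d_K|^A)^{L₆} ≤ |d_K|^{(A+1) L₆}`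
    set d : ℝ := ((NumberField.discr K).natAbs : ℝ) with hd
    have hd1 : (1 : ℝ) ≤ d := by
      have h1 := Int.one_le_abs (NumberField.discr_ne_zero K)
      rw [Int.abs_eq_natAbs] at h1; rw [hd]; exact_mod_cast h1
    have hdNK : ((NumberField.discr N).natAbs : ℝ) ≤ d ^ (A : ℝ) := by
      rw [Real.rpow_natCast, hd]; exact_mod_cast hdN
    calc (p : ℝ) ≤ ((NumberField.discr N).natAbs : ℝ) ^ L₆ := hple
      _ ≤ (d ^ (A : ℝ)) ^ L₆ := Real.rpow_le_rpow (Nat.cast_nonneg _) hdNK hL₆.le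
      _ = d ^ ((A : ℝ) * L₆) := by rw [← Real.rpow_mul (by linarith)]
      _ ≤ d ^ (((A : ℝ) + 1) * L₆) :=
          Real.rpow_le_rpow_of_exponent_le hd1 (by nlinarith)
  · rw [ArithmeticallyEquivalent.of_algEquiv eK p hp]; exact hT

end Summit.QuantumAdvantage.QuantumAdvantage.Theorems.DegreeOnePrimesEscape

end
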